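import Summits.QuantumFields.YangMills.Theorems.BalabanUVNodesN12DirectSurjHsurjL1
import Literature.MathematicalPhysics.QuantumFieldTheory.Balaban1983to89.Node00.DomainsOfSeq

/-!
# BalabanUVNodes ∕ N12 — (P4)′, THE HULL COUNT: every constraint row of `𝐁_k(Z)` (indeed of ANY determining set) admits a level-graded family closed for its one-row charge inside a
# finset of at most `h(d,L,k) = 2d(k+1)·(2d+1)^k·L^{kd}` fine bonds — the hypothesis `hhull` of p685789 DISCHARGED with `h` EXPLICIT in `(d, L, k)` (no torus size, no region count)

Cell `pub-ymgap` (HUMAN RULINGS D-0062 ∕ D-0149), WIDTH SEAT `pub-ymgap-dag-n12-w6` g9 (node N12 = [B15]; key K1⁹ `stmt-QuantumFields-27364`, `--kind proof --supports … --as helper`;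
count-neutral).  THEOREMS ONLY (0 `def`, 0 `instance`, 0 `sorry`).  Sequel of `…N12DirectSurjHsurjL1` (p685789: the row-wise superposition `H′` of the support edition's right inverse and its
ℓ¹ → ℓ¹ letter `Σ_b ‖H′ v b‖ ≤ h·B·Σ_i ‖v_i‖` MODULO the displayed hull count `hhull(h)`), lane census `N12-DIRECT-ROW-CENSUS-2026-08-28.md` §7 U2b ∕ `N12-UNIFORMITY-SPEC.md` §5 (the (μ) row's
letter `B₁ = h·B`, dag-n12-c g22 ρ6b `…DirectChartPackageOfClassRowL1`: per-row ℓ¹ preimage letter `hrow`).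

WHY ∕ THE CONSTRUCTION (pure lattice bookkeeping — no metric, no contraction argument).  The closure clauses (a)(b) of `hHsupp″` for the one-row charge at the row `i = (j₀, c₀)` read: (a) if
`j₀ = 0` the bond `c₀` itself; (b) at a level `j ≥ 1`, a row `c` is CHARGED if it is `c₀` or if a bond `b₁` of a LOWER grade `𝒮 m`, `m < j`, has both its end-points' `j`-block points among
`{c₋, c₊}`; a charged row puts (some of) the fine bonds of the `j`-blocks of its end-points into `𝒮 j`.  Take two fine sites `x₁ = ι_{j₀} c₀₋`, `x₂ = ι_{j₀} c₀₊` and the LEVEL SETS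
`A 0 := {x₁, x₂} ⊆ T^{(0)}`, `A (n+1) := blk(A n) ∪ (blk(A n) ± e_μ)` (`#A n ≤ 2(2d+1)^n`); put `𝒮 j := {b₀ | B^j(b₀₋) ∈ A j}` for `j ≤ k` (all fine bonds sourced in the `j`-blocks over
`A j`; `#𝒮 j = #A j · d · L^{jd}` by `card_iterBlock`) and `𝒮 j := ∅` above `k`.  Closure: a witness `b₁ ∈ 𝒮 m` has `B^m(b₁₋) ∈ A m`, hence `B^{j−1}(b₁₋) ∈ A (j−1)` (the level sets are
closed under `blk`), so `B^j(b₁₋) ∈ blk(A (j−1))` is a PIVOT and a row incident to it has BOTH end-points in `blk(A (j−1)) ∪ (blk(A (j−1)) ± e_μ) = A j`; the row `c₀` itself has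
`c₀± = B^{j₀}(x_{1,2}) ∈ A j₀`.  Total: `#⋃_{j≤k} 𝒮 j ≤ Σ_{j≤k} 2(2d+1)^j·d·L^{jd} ≤ 2d(k+1)(2d+1)^k L^{kd}`.

CONTENTS.  §1 lattice bookkeeping: `exists_levelSets` (the family `A`), `iterBlockOf_add_mem` ∕ `iterBlockOf_mem_of_le` (closed under the block tower), `src_tgt_mem_of_incident` (pivots),
`mem_hullLevel_iff` ∕ `card_hullLevel_le` (the level hull `{b₀ | B^j(b₀₋) ∈ S}` as a finset and its count).  §2 ★★ `exists_rowHull` — for ANY determining set `𝐁` and `k ≤ m+K`: every row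
admits a closed graded family inside `≤ h(d,L,k)` bonds (closure in a form STRONGER than `hHsupp″`'s: no inner-site and no face condition needed); `exists_rowHull_Bj` — the same in p685789's
`hhull` text verbatim.  §3 ★★★ `exists_rightInverse_l1Letter_explicit` — p678596's hypotheses VERBATIM ⟹ `∃ H′, (DΨ(0) ∘ H′ = id) ∧ (‖H′ v‖ ≤ B·Σ_i ‖v_i‖) ∧ (Σ_b ‖H′ v b‖ ≤ h(d,L,k)·B·Σ_i ‖v_i‖) ∧
(∀ i ξ, Σ_b ‖↑(H′ (e_i ξ))_b‖_op ≤ h(d,L,k)·B·‖ξ‖)`; ★★★ `exists_rightInverse_hrow_explicit` — the same packaged as `∃ H, hHinv ∧ hrow` with the lane's per-row ℓ¹ preimage letter `hrow`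
(ρ6b `chartRows_direct_of_class_rowl1`'s binder text) at `B₁ := h(d,L,k)·B` — the one-term re-key for dag-n12-d's `exists_rowPreimageProxiesLetter_family` (today `B₁ = √#{b | b.src ∈ Ω₁(Z)}·B`).

HONEST FRAMING.  Lattice bookkeeping + bookkeeping by name over landed kernel theorems; the hull count is now EXPLICIT in `(d, L, k)`; the sup-norm letter `B` stays per instance (`(M₁, Z)`:
dag-n12-w6 LOCATED-B, census U4) — print's volume-free (46) is NOT claimed; nothing of Bałaban's asserted or refuted; N12 NOT discharged; K1⁹ NOT closed; count-neutral; R4 closes only the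
conditional finite-`𝕋⁴` rung `BalabanLadder.UV`; no summit statement is proved here and NOT the Yang–Mills mass gap (Clay); nothing continuum ∕ ℝ⁴ ∕ OS.
-/

noncomputable section

open scoped BigOperators Matrix.Norms.L2Operator Topology NNReal
open Filter

namespace Summit.QuantumFields.YangMills.BalabanUVNodes.N12DirectSurjHullCount

open Literature.MathematicalPhysics.QuantumFieldTheory.Balaban1983to89
open Node00 B15DeterminingSets
open T4Continuum (T4Family)
open T4AdjointCovarianceUnitary (lieSU)
open B14.Eq213DetSet (Bj maxDomT)
open B14.Eq213MaximalDomains (side)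
open B14.Eq216Concrete (feeds)
open B5Eq118OneStroke (iterBlockOf iterBlock mem_iterBlock card_iterBlock iterBlockOf_zero iterBlockOf_succ)
open B15Eq112TorusCover (lift)
open T4AxialGaugeSmallField (boxPlaqs)
open B10StarCount (unshift_shift)
open B16Ineq19NearFlatSliceNorms (opNorm_coe_le_norm_lieSU)
open Summit.QuantumFields.YangMills.BalabanUVNodes.N12DirectSurjHsurjL1 (sum_norm_le_card_mul_norm_of_subset exists_rightInverse_l1Letter_of_proxies)

/-! ## §1  Lattice bookkeeping: level sets closed under block points and their face-neighbours -/

section Lattice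

variable {P : Params}

/-- **THE LEVEL SETS.**  From two fine sites `x₁, x₂ ∈ T^{(0)}`: a family `A n ⊆ T^{(n)}` with `x₁, x₂ ∈ A 0`, CLOSED under «block point, and the block point's face-neighbours»
(`blockOf w`, `blockOf w ± e_μ ∈ A (n+1)` for `w ∈ A n`), with `#A n ≤ 2·(2d+1)^n` (each step: image under `blockOf`, then `2d` translates). [cite: Balaban1987RG1, (0.1)–(0.3) pp.251–252 (lattice bookkeeping)] -/
theorem exists_levelSets (x₁ x₂ : Site P 0) :
    ∃ A : (n : ℕ) → Finset (Site P n), x₁ ∈ A 0 ∧ x₂ ∈ A 0 ∧ (∀ n, (A n).card ≤ 2 * (2 * P.d + 1) ^ n) ∧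
      ∀ n, ∀ w ∈ A n, blockOf w ∈ A (n + 1) ∧ ∀ μ : Fin P.d, (blockOf w).shift μ ∈ A (n + 1) ∧ (blockOf w).unshift μ ∈ A (n + 1) := by
  classical
  let E : (n : ℕ) → Finset (Site P n) → Finset (Site P (n + 1)) := fun n S =>
    S.image blockOf ∪ ((S.image blockOf ×ˢ (Finset.univ : Finset (Fin P.d))).image fun p => p.1.shift p.2) ∪
      ((S.image blockOf ×ˢ (Finset.univ : Finset (Fin P.d))).image fun p => p.1.unshift p.2)
  let A : (n : ℕ) → Finset (Site P n) := fun n =>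
    Nat.rec (motive := fun n => Finset (Site P n)) ({x₁, x₂} : Finset (Site P 0)) (fun n S => E n S) n
  have hA0 : A 0 = {x₁, x₂} := rfl
  have hAs : ∀ n, A (n + 1) = E n (A n) := fun n => rfl
  have hE : ∀ (n : ℕ) (S : Finset (Site P n)), (E n S).card ≤ (2 * P.d + 1) * S.card := by
    intro n S
    have h1 : (S.image blockOf).card ≤ S.card := Finset.card_image_le
    have h2 : ((S.image blockOf ×ˢ (Finset.univ : Finset (Fin P.d))).image (fun p => p.1.shift p.2)).card ≤ S.card * P.d := by
      refine Finset.card_image_le.trans ?_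
      rw [Finset.card_product, Finset.card_univ, Fintype.card_fin]
      exact Nat.mul_le_mul_right _ h1
    have h3 : ((S.image blockOf ×ˢ (Finset.univ : Finset (Fin P.d))).image (fun p => p.1.unshift p.2)).card ≤ S.card * P.d := by
      refine Finset.card_image_le.trans ?_
      rw [Finset.card_product, Finset.card_univ, Fintype.card_fin]
      exact Nat.mul_le_mul_right _ h1
    calc (E n S).card ≤ (S.image blockOf ∪ ((S.image blockOf ×ˢ (Finset.univ : Finset (Fin P.d))).image fun p => p.1.shift p.2)).card +
          ((S.image blockOf ×ˢ (Finset.univ : Finset (Fin P.d))).image (fun p => p.1.unshift p.2)).card := Finset.card_union_le _ _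
      _ ≤ ((S.image blockOf).card + ((S.image blockOf ×ˢ (Finset.univ : Finset (Fin P.d))).image (fun p => p.1.shift p.2)).card) +
          ((S.image blockOf ×ˢ (Finset.univ : Finset (Fin P.d))).image (fun p => p.1.unshift p.2)).card :=
            Nat.add_le_add_right (Finset.card_union_le _ _) _
      _ ≤ (S.card + S.card * P.d) + S.card * P.d := Nat.add_le_add (Nat.add_le_add h1 h2) h3
      _ = (2 * P.d + 1) * S.card := by ring
  refine ⟨A, by rw [hA0]; simp, by rw [hA0]; simp, fun n => ?_, fun n w hw => ?_⟩
  · induction n with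
    | zero => rw [hA0, pow_zero, mul_one]; exact Finset.card_le_two
    | succ n ih =>
      rw [hAs]
      calc (E n (A n)).card ≤ (2 * P.d + 1) * (A n).card := hE n (A n)
        _ ≤ (2 * P.d + 1) * (2 * (2 * P.d + 1) ^ n) := Nat.mul_le_mul_left _ ih
        _ = 2 * (2 * P.d + 1) ^ (n + 1) := by ring
  · have hb : blockOf w ∈ (A n).image blockOf := Finset.mem_image_of_mem _ hw
    refine ⟨?_, fun μ => ⟨?_, ?_⟩⟩
    · rw [hAs]; exact Finset.mem_union_left _ (Finset.mem_union_left _ hb)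
    · rw [hAs]
      exact Finset.mem_union_left _ (Finset.mem_union_right _
        (Finset.mem_image.2 ⟨(blockOf w, μ), Finset.mem_product.2 ⟨hb, Finset.mem_univ _⟩, rfl⟩))
    · rw [hAs]
      exact Finset.mem_union_right _ (Finset.mem_image.2 ⟨(blockOf w, μ), Finset.mem_product.2 ⟨hb, Finset.mem_univ _⟩, rfl⟩)

/-- The level sets are closed under the block tower: if `B^m(x) ∈ A m` then `B^{m+n}(x) ∈ A (m+n)`. [cite: Balaban1984PropagatorsI, (1.16)–(1.18) p.20 (nested blocks)] -/
theorem iterBlockOf_add_mem {A : (n : ℕ) → Finset (Site P n)} (hA : ∀ n, ∀ w ∈ A n, blockOf w ∈ A (n + 1)) (x : Site P 0) {m : ℕ}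
    (hm : iterBlockOf m x ∈ A m) : ∀ n : ℕ, iterBlockOf (m + n) x ∈ A (m + n)
  | 0 => hm
  | n + 1 => hA _ _ (iterBlockOf_add_mem hA x hm n)

/-- The level sets are closed under the block tower (`≤` form). [cite: Balaban1984PropagatorsI, (1.16)–(1.18) p.20 (nested blocks)] -/
theorem iterBlockOf_mem_of_le {A : (n : ℕ) → Finset (Site P n)} (hA : ∀ n, ∀ w ∈ A n, blockOf w ∈ A (n + 1)) (x : Site P 0) {m n : ℕ}
    (hmn : m ≤ n) (hm : iterBlockOf m x ∈ A m) : iterBlockOf n x ∈ A n := by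
  obtain ⟨t, rfl⟩ := Nat.exists_eq_add_of_le hmn
  exact iterBlockOf_add_mem hA x hm t

/-- **PIVOTS.**  A bond of `T^{(n+1)}` incident to the block point of some `w ∈ A n` has BOTH end-points in `A (n+1)` (the other end-point is a face-neighbour `blockOf w ± e_μ`).
[cite: Balaban1987RG1, (0.3) p.252 (lattice bookkeeping)] -/
theorem src_tgt_mem_of_incident {A : (n : ℕ) → Finset (Site P n)}
    (hA : ∀ n, ∀ w ∈ A n, blockOf w ∈ A (n + 1) ∧ ∀ μ : Fin P.d, (blockOf w).shift μ ∈ A (n + 1) ∧ (blockOf w).unshift μ ∈ A (n + 1))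
    {n : ℕ} {w : Site P n} (hw : w ∈ A n) (c : PBond P (n + 1)) (hc : c.src = blockOf w ∨ c.tgt = blockOf w) :
    c.src ∈ A (n + 1) ∧ c.tgt ∈ A (n + 1) := by
  obtain ⟨hb, hμ⟩ := hA n w hw
  rcases hc with h | h
  · refine ⟨h ▸ hb, ?_⟩
    show c.src.shift c.dir ∈ A (n + 1)
    rw [h]
    exact (hμ c.dir).1
  · have hs : c.src = (blockOf w).unshift c.dir := by
      rw [← h]
      exact (unshift_shift c.src c.dir).symm
    rw [hs, h]
    exact ⟨(hμ c.dir).2, hb⟩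

/-- The LEVEL HULL over a site set `S ⊆ T^{(j)}` — all fine bonds sourced in the `j`-blocks over `S` — as a finset: membership. [cite: Balaban1984PropagatorsI, (1.18) p.20 (blocks of order `j`)] -/
theorem mem_hullLevel_iff {j : ℕ} (S : Finset (Site P j)) (b₀ : PBond P 0) :
    b₀ ∈ ((S.biUnion (iterBlock j)) ×ˢ (Finset.univ : Finset (Fin P.d))).image (fun p : Site P 0 × Fin P.d => (⟨p.1, p.2⟩ : PBond P 0)) ↔
      iterBlockOf j b₀.src ∈ S := by
  classical
  constructor
  · intro h
    obtain ⟨p, hp, rfl⟩ := Finset.mem_image.1 h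
    obtain ⟨hp1, -⟩ := Finset.mem_product.1 hp
    obtain ⟨y, hy, hpy⟩ := Finset.mem_biUnion.1 hp1
    rw [mem_iterBlock] at hpy
    show iterBlockOf j p.1 ∈ S
    rw [hpy]
    exact hy
  · intro h
    refine Finset.mem_image.2 ⟨(b₀.src, b₀.dir), Finset.mem_product.2 ⟨Finset.mem_biUnion.2 ⟨_, h, (mem_iterBlock _ _ _).2 rfl⟩, Finset.mem_univ _⟩, ?_⟩
    cases b₀
    rfl

/-- The count of the level hull: `#{b₀ | B^j(b₀₋) ∈ S} ≤ #S · L^{jd} · d` (`card_iterBlock`; standing range `j ≤ m + K`). [cite: Balaban1984PropagatorsI, (1.18) p.20 (`|B^j(y)| = L^{jd}`)] -/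
theorem card_hullLevel_le {j : ℕ} (hj : j ≤ P.m + P.K) (S : Finset (Site P j)) :
    (((S.biUnion (iterBlock j)) ×ˢ (Finset.univ : Finset (Fin P.d))).image (fun p : Site P 0 × Fin P.d => (⟨p.1, p.2⟩ : PBond P 0))).card ≤
      S.card * (P.L ^ P.d) ^ j * P.d := by
  classical
  refine Finset.card_image_le.trans ?_
  rw [Finset.card_product, Finset.card_univ, Fintype.card_fin]
  refine Nat.mul_le_mul_right _ (Finset.card_biUnion_le.trans ?_)
  rw [Finset.sum_congr rfl fun y _ => card_iterBlock j hj y, Finset.sum_const, smul_eq_mul]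

end Lattice

/-! ## §2  The hull of one row -/

section Hull

variable {P : Params}

/-- ★★ **THE HULL OF ONE ROW** (any determining set `𝐁`, `k ≤ m + K`): every row `i = (j₀, c₀)` of the constraint enumeration admits a LEVEL-GRADED family `𝒮` inside a finset `T` of at most
`h(d,L,k) = 2d(k+1)·(2d+1)^k·L^{kd}` fine bonds which is CLOSED for the one-row charge at `i`: (a) if `j₀ = 0`, `c₀ ∈ 𝒮 0`; (b) for every level-`j` row `c` (`1 ≤ j ≤ k`) which IS the row `i`
or has both end-points' `j`-block points of some `b₁ ∈ 𝒮 m`, `m < j`, among `{c₋, c₊}`: EVERY fine bond whose source's `j`-block point is an end-point of `c` lies in `𝒮 j` (stronger than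
`hHsupp″`'s clause: no inner-site and no face condition). [cite: Balaban1988Convergent, (2.2) p.255, (2.10)–(2.13) pp.256–257; Balaban1984PropagatorsI, (1.18) p.20] -/
theorem exists_rowHull (𝔹 : DetSet P) {k : ℕ} (hk : k ≤ P.m + P.K) (i : Fin (constrCard 𝔹 k)) :
    ∃ (𝒮 : ℕ → Set (PBond P 0)) (T : Finset (PBond P 0)),
      (∀ m, ∀ b ∈ 𝒮 m, b ∈ T) ∧ T.card ≤ 2 * P.d * (k + 1) * (2 * P.d + 1) ^ k * (P.L ^ P.d) ^ k ∧
      (∀ (b : PBond P 0) (hb : b ∈ bondsOf (𝔹 0)), constrEnum 𝔹 k ⟨⟨0, Nat.succ_pos k⟩, b, hb⟩ = i → b ∈ 𝒮 0) ∧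
      (∀ (j : ℕ) (_ : 1 ≤ j) (hjk : j ≤ k) (c : PBond P j) (hc : c ∈ bondsOf (𝔹 j)),
        (constrEnum 𝔹 k ⟨⟨j, Nat.lt_succ_of_le hjk⟩, c, hc⟩ = i ∨
          ∃ m, m < j ∧ ∃ b₀ ∈ 𝒮 m, (iterBlockOf j b₀.src = c.src ∨ iterBlockOf j b₀.src = c.tgt) ∧ (iterBlockOf j b₀.tgt = c.src ∨ iterBlockOf j b₀.tgt = c.tgt)) →
        ∀ y : Site P j, (c.src = y ∨ c.tgt = y) → ∀ b₀ : PBond P 0, iterBlockOf j b₀.src = y → b₀ ∈ 𝒮 j) := by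
  classical
  set r := (constrEnum 𝔹 k).symm i with hr
  obtain ⟨A, hx₁, hx₂, hcard, hA⟩ := exists_levelSets (P := P) (embIter ((r.1 : ℕ)) r.2.1.src) (embIter ((r.1 : ℕ)) r.2.1.tgt)
  have hAb : ∀ n, ∀ w ∈ A n, blockOf w ∈ A (n + 1) := fun n w hw => (hA n w hw).1
  -- the level hulls
  let Tj : (j : ℕ) → Finset (PBond P 0) := fun j =>
    (((A j).biUnion (iterBlock j)) ×ˢ (Finset.univ : Finset (Fin P.d))).image fun p : Site P 0 × Fin P.d => (⟨p.1, p.2⟩ : PBond P 0)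
  have hTj : ∀ (j : ℕ) (b₀ : PBond P 0), b₀ ∈ Tj j ↔ iterBlockOf j b₀.src ∈ A j := fun j b₀ => mem_hullLevel_iff (A j) b₀
  refine ⟨fun j => {b₀ | j ≤ k ∧ b₀ ∈ Tj j}, (Finset.range (k + 1)).biUnion Tj, ?_, ?_, ?_, ?_⟩
  · -- every grade lies in `T`
    rintro m b ⟨hm, hb⟩
    exact Finset.mem_biUnion.2 ⟨m, Finset.mem_range.2 (Nat.lt_succ_of_le hm), hb⟩
  · -- the count
    have hL : 0 < P.L ^ P.d := pow_pos P.L_pos _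
    calc ((Finset.range (k + 1)).biUnion Tj).card ≤ ∑ j ∈ Finset.range (k + 1), (Tj j).card := Finset.card_biUnion_le
      _ ≤ ∑ _j ∈ Finset.range (k + 1), 2 * P.d * (2 * P.d + 1) ^ k * (P.L ^ P.d) ^ k := Finset.sum_le_sum fun j hj => ?_
      _ = 2 * P.d * (k + 1) * (2 * P.d + 1) ^ k * (P.L ^ P.d) ^ k := by rw [Finset.sum_const, Finset.card_range, smul_eq_mul]; ring
    have hjk : j ≤ k := Nat.lt_succ_iff.1 (Finset.mem_range.1 hj)
    calc (Tj j).card ≤ (A j).card * (P.L ^ P.d) ^ j * P.d := card_hullLevel_le (hjk.trans hk) (A j)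
      _ ≤ (2 * (2 * P.d + 1) ^ j) * (P.L ^ P.d) ^ j * P.d := Nat.mul_le_mul_right _ (Nat.mul_le_mul_right _ (hcard j))
      _ ≤ (2 * (2 * P.d + 1) ^ k) * (P.L ^ P.d) ^ k * P.d :=
          Nat.mul_le_mul_right _ (Nat.mul_le_mul (Nat.mul_le_mul_left _ (Nat.pow_le_pow_right (by omega) hjk)) (Nat.pow_le_pow_right hL hjk))
      _ = 2 * P.d * (2 * P.d + 1) ^ k * (P.L ^ P.d) ^ k := by ring
  · -- (a): the level-`0` row itself
    intro b hb h
    have hrb : r = ⟨⟨0, Nat.succ_pos k⟩, b, hb⟩ := by rw [hr, ← h, Equiv.symm_apply_apply]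
    show 0 ≤ k ∧ b ∈ Tj 0
    refine ⟨Nat.zero_le _, (hTj 0 b).2 ?_⟩
    have e : embIter ((r.1 : ℕ)) r.2.1.src = b.src := by rw [hrb]; rfl
    rw [iterBlockOf_zero, ← e]
    exact hx₁
  · -- (b): charged rows of level `j ≥ 1`
    intro j hj hjk c hc hcharged y hy b₀ hb₀
    show j ≤ k ∧ b₀ ∈ Tj j
    refine ⟨hjk, (hTj j b₀).2 ?_⟩
    rw [hb₀]
    suffices hct : c.src ∈ A j ∧ c.tgt ∈ A j by
      rcases hy with rfl | rfl
      exacts [hct.1, hct.2]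
    rcases hcharged with h | ⟨m, hmj, b₁, ⟨-, hb₁⟩, hsrc, -⟩
    · -- the row `c` is the row `i`: its end-points are the `j`-block points of `x₁, x₂`
      have hrc : r = ⟨⟨j, Nat.lt_succ_of_le hjk⟩, c, hc⟩ := by rw [hr, ← h, Equiv.symm_apply_apply]
      have hjm : j ≤ P.m + P.K := hjk.trans hk
      have e1 : embIter ((r.1 : ℕ)) r.2.1.src = embIter j c.src := by rw [hrc]
      have e2 : embIter ((r.1 : ℕ)) r.2.1.tgt = embIter j c.tgt := by rw [hrc]
      have h1 : iterBlockOf j (embIter j c.src) ∈ A j :=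
        iterBlockOf_mem_of_le hAb (embIter j c.src) (Nat.zero_le j) (by rw [iterBlockOf_zero, ← e1]; exact hx₁)
      have h2 : iterBlockOf j (embIter j c.tgt) ∈ A j :=
        iterBlockOf_mem_of_le hAb (embIter j c.tgt) (Nat.zero_le j) (by rw [iterBlockOf_zero, ← e2]; exact hx₂)
      rw [iterBlockOf_embIter_eq hjm] at h1 h2
      exact ⟨h1, h2⟩
    · -- charged through a lower grade: `B^j(b₁₋)` is a pivot
      obtain ⟨j', rfl⟩ : ∃ j', j = j' + 1 := ⟨j - 1, by omega⟩
      have hb₁A : iterBlockOf m b₁.src ∈ A m := (hTj m b₁).1 hb₁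
      have hw : iterBlockOf j' b₁.src ∈ A j' := iterBlockOf_mem_of_le hAb b₁.src (Nat.lt_succ_iff.1 hmj) hb₁A
      refine src_tgt_mem_of_incident hA hw c ?_
      rcases hsrc with h | h
      exacts [Or.inl h.symm, Or.inr h.symm]

/-- **THE HULL OF ONE ROW, `hhull` TEXT.**  `exists_rowHull` for `𝐁 = 𝐁_k(Z)` in the exact text of p685789's hypothesis `hhull (h := 2d(k+1)·(2d+1)^k·L^{kd})` (clause (b) weakened to the
inner-site ∕ internal-face form of `hHsupp″`). [cite: Balaban1988Convergent, (2.2) p.255, (2.10)–(2.13) pp.256–257; Balaban1984PropagatorsI, (1.18) p.20] -/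
theorem exists_rowHull_Bj {k : ℕ} (hk : k ≤ P.m + P.K) (M₁ : ℕ) (Z : Set (Site P 0)) (i : Fin (constrCard (Bj M₁ Z k) k)) :
    ∃ (𝒮 : ℕ → Set (PBond P 0)) (T : Finset (PBond P 0)),
      (∀ m, ∀ b ∈ 𝒮 m, b ∈ T) ∧ T.card ≤ 2 * P.d * (k + 1) * (2 * P.d + 1) ^ k * (P.L ^ P.d) ^ k ∧
      (∀ (b : PBond P 0) (hb : b ∈ bondsOf (Bj M₁ Z k 0)), constrEnum (Bj M₁ Z k) k ⟨⟨0, Nat.succ_pos k⟩, b, hb⟩ = i → b ∈ 𝒮 0) ∧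
      (∀ (j : ℕ) (hj : 1 ≤ j) (hjk : j ≤ k) (c : PBond P j) (hc : c ∈ bondsOf (Bj M₁ Z k j)),
        (constrEnum (Bj M₁ Z k) k ⟨⟨j, Nat.lt_succ_of_le hjk⟩, c, hc⟩ = i ∨
          ∃ m, m < j ∧ ∃ b₀ ∈ 𝒮 m, (iterBlockOf j b₀.src = c.src ∨ iterBlockOf j b₀.src = c.tgt) ∧ (iterBlockOf j b₀.tgt = c.src ∨ iterBlockOf j b₀.tgt = c.tgt)) →
        ∀ y : Site P j, (c.src = y ∨ c.tgt = y) → embIter j y ∈ maxDomT M₁ Z j →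
        ∀ b₀ : PBond P 0, iterBlockOf j b₀.src = y → iterBlockOf j b₀.tgt = y → iterBlockOf (j - 1) b₀.src ≠ iterBlockOf (j - 1) b₀.tgt → b₀ ∈ 𝒮 j) := by
  obtain ⟨𝒮, T, hT, hcard, ha, hb⟩ := exists_rowHull (Bj M₁ Z k) hk i
  exact ⟨𝒮, T, hT, hcard, ha, fun j hj hjk c hc hch y hy _ b₀ hs _ _ => hb j hj hjk c hc hch y hy b₀ hs⟩

end Hull

/-! ## §3  The ℓ¹ → ℓ¹ letter and the per-row ℓ¹ preimage letter with the EXPLICIT hull count -/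

section Record

variable {F : T4Family} {N : ℕ} [NeZero N] {K k : ℕ}

/-- ★★★ **(P4)′ IN THE ℓ¹ → ℓ¹ CURRENCY WITH THE EXPLICIT HULL COUNT.**  Under p678596's hypotheses VERBATIM (`k + 1 ≤ m + K`; `ε > 0` per height; per `M₁ ≥ 1`, `Z` with (2.13)'s
divisibility the sup-norm letter `B ≥ 0` of the support edition; fibre condition, proxies `hprox`∕`hproxSite`, box plaquette letter): a right inverse `H′` of `DΨ_{𝐁_k(Z),W,U₀}(0)` with
`‖H′ v‖ ≤ B·Σ_i ‖v_i‖`, the ℓ¹ → ℓ¹ letter `Σ_b ‖H′ v b‖ ≤ h·B·Σ_i ‖v_i‖` and, row by row, `Σ_b ‖↑(H′ (e_i ξ))_b‖_op ≤ h·B·‖ξ‖` (the ∀-body of the lane's per-row ℓ¹ preimage letter `hrow`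
at `B₁ := h·B`, for EVERY row `i`), where `h = 2d(k+1)·(2d+1)^k·L^{kd}` — p685789's `hhull` DISCHARGED by `exists_rowHull_Bj`. [cite: Balaban1985Variational, (83) p.290, (44)-(47) p.285;
Balaban1988Convergent, (2.10)-(2.13) pp.256-257; Balaban1987RG1, (0.4) p.253] -/
theorem exists_rightInverse_l1Letter_explicit (hkK : k + 1 ≤ (F.P K).m + (F.P K).K) :
    ∃ ε : ℝ, 0 < ε ∧ ∀ (M₁ : ℕ) (_ : 1 ≤ M₁) (Z : Set (Site (F.P K) 0)) (_ : side (F.P K).L M₁ k ∣ (F.P K).sitesPerDir 0),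
      ∃ B : ℝ, 0 ≤ B ∧ ∀ (W : MSField (F.P K) (SU N)) (U₀ : GaugeField (F.P K) 0 (SU N)),
        AgreeOn (Bj M₁ Z k) (avgFamily (avOfRecord F N K) U₀) W →
        (∀ i : Fin (constrCard (Bj M₁ Z k) k), ∃ U' : GaugeField (F.P K) 0 (SU N),
          (∀ b ∈ feeds (((constrEnum (Bj M₁ Z k) k).symm i).1 : ℕ) ((constrEnum (Bj M₁ Z k) k).symm i).2.1, U' b = U₀ b) ∧ SmallBelow (avOfRecord F N K) k U') →
        (∀ (j : ℕ), 1 ≤ j → j ≤ k → ∀ y : Site (F.P K) j, embIter j y ∈ maxDomT M₁ Z j → ∃ U' : GaugeField (F.P K) 0 (SU N),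
          (∀ c : PBond (F.P K) j, (c.src = y ∨ c.tgt = y) → ∀ b₀ : PBond (F.P K) 0,
            (iterBlockOf j b₀.src = c.src ∨ iterBlockOf j b₀.src = c.tgt) → (iterBlockOf j b₀.tgt = c.src ∨ iterBlockOf j b₀.tgt = c.tgt) → U' b₀ = U₀ b₀) ∧
          SmallBelow (avOfRecord F N K) k U') →
        (∀ (j : ℕ), 1 ≤ j → j ≤ k → ∀ y : Site (F.P K) j, embIter j y ∈ maxDomT M₁ Z j →
          PlaqSmallOn (boxPlaqs (P := F.P K) (j := 0)
            (fun κ => lift (F.P K) (embIter j y) κ - ((((F.P K).L ^ j : ℕ) : ℤ) + ((((F.P K).L ^ j - 1) / 2 : ℕ) : ℤ)))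
            (fun κ => lift (F.P K) (embIter j y) κ + ((((F.P K).L ^ j : ℕ) : ℤ) + ((((F.P K).L ^ j - 1) / 2 : ℕ) : ℤ)))) ε U₀) →
        ∃ H : (Fin (constrCard (Bj M₁ Z k) k) → lieSU (Fin N)) → PBond (F.P K) 0 → lieSU (Fin N),
          (∀ v, fderiv ℝ (msChart F N K k (Bj M₁ Z k) W U₀) 0 (H v) = v) ∧
          (∀ v, ‖H v‖ ≤ B * ∑ i, ‖v i‖) ∧
          (∀ v, ∑ b, ‖H v b‖ ≤ (2 * (F.P K).d * (k + 1) * (2 * (F.P K).d + 1) ^ k * ((F.P K).L ^ (F.P K).d) ^ k : ℕ) * B * ∑ i, ‖v i‖) ∧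
          ∀ (i : Fin (constrCard (Bj M₁ Z k) k)) (ξ : lieSU (Fin N)),
            ∑ b, ‖((H (Pi.single i ξ) b : lieSU (Fin N)) : Matrix (Fin N) (Fin N) ℂ)‖
              ≤ (2 * (F.P K).d * (k + 1) * (2 * (F.P K).d + 1) ^ k * ((F.P K).L ^ (F.P K).d) ^ k : ℕ) * B * ‖ξ‖ := by
  classical
  have hk : k ≤ (F.P K).m + (F.P K).K := Nat.le_of_succ_le hkK
  obtain ⟨ε, hε, hmain⟩ := exists_rightInverse_l1Letter_of_proxies (F := F) (N := N) (K := K) (k := k) hkK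
  refine ⟨ε, hε, fun M₁ hM1 Z hdiv => ?_⟩
  obtain ⟨B, hB0, hB⟩ := hmain M₁ hM1 Z hdiv
  refine ⟨B, hB0, fun W U₀ hU hprox hproxSite hplaq => ?_⟩
  obtain ⟨H, hHinv, hHsup, hHl1⟩ := hB W U₀ hU hprox hproxSite hplaq
  have hl1 := hHl1 (2 * (F.P K).d * (k + 1) * (2 * (F.P K).d + 1) ^ k * ((F.P K).L ^ (F.P K).d) ^ k) fun i => exists_rowHull_Bj hk M₁ Z i
  refine ⟨H, hHinv, hHsup, hl1, fun i ξ => ?_⟩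
  -- one-row data: `Σ_{i'} ‖(e_i ξ) i'‖ = ‖ξ‖`, operator norm ≤ Hilbert–Schmidt norm
  have hsum : ∑ i', ‖Pi.single (M := fun _ => lieSU (Fin N)) i ξ i'‖ = ‖ξ‖ := by
    rw [Finset.sum_eq_single i (fun i' _ hi' => by rw [Pi.single_eq_of_ne hi', norm_zero]) (fun h => absurd (Finset.mem_univ i) h), Pi.single_eq_same]
  calc ∑ b, ‖((H (Pi.single i ξ) b : lieSU (Fin N)) : Matrix (Fin N) (Fin N) ℂ)‖ ≤ ∑ b, ‖H (Pi.single i ξ) b‖ :=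
        Finset.sum_le_sum fun b _ => opNorm_coe_le_norm_lieSU _
    _ ≤ (2 * (F.P K).d * (k + 1) * (2 * (F.P K).d + 1) ^ k * ((F.P K).L ^ (F.P K).d) ^ k : ℕ) * B * ∑ i', ‖Pi.single (M := fun _ => lieSU (Fin N)) i ξ i'‖ := hl1 _
    _ = (2 * (F.P K).d * (k + 1) * (2 * (F.P K).d + 1) ^ k * ((F.P K).L ^ (F.P K).d) ^ k : ℕ) * B * ‖ξ‖ := by rw [hsum]


/-- ★★★ **THE PER-ROW ℓ¹ PREIMAGE LETTER `hrow` WITH THE EXPLICIT HULL COUNT** — the lane's ρ6b socket text (`N12DirectChartPackageOfClassRowL1.chartRows_direct_of_class_rowl1`, binder `hrow`;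
consumer `N12Prop1DirectOfClassOnlyRowL1.exists_rowPreimageProxiesLetter_family`) inhabited at `B₁ := h(d,L,k)·B`, `h = 2d(k+1)·(2d+1)^k·L^{kd}`: under p678596's hypotheses VERBATIM,
`∃ H, (DΨ(0) ∘ H = id) ∧ ∀ i, 1 ≤ level i → ∀ ξ, ∃ x, DΨ(0) x = e_i ξ ∧ Σ_b ‖↑x_b‖_op ≤ (h·B)·‖ξ‖` (`x := H (e_i ξ)`, `H` the row-wise superposition of `exists_rightInverse_l1Letter_explicit`;
the level guard is not used — every row qualifies).  Replaces today's inhabitant `B₁ = √#{b | b.src ∈ Ω₁(Z)}·B` (`…RowL1Family.hrow_of_hHB`): NO region ∕ torus count left in `B₁` but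
through `B` itself (per instance, LOCATED-B). [cite: Balaban1985Variational, (45)–(46) p.285, (83) p.290; Balaban1988Convergent, (2.2) p.255, (2.10)-(2.13) pp.256-257] -/
theorem exists_rightInverse_hrow_explicit (hkK : k + 1 ≤ (F.P K).m + (F.P K).K) :
    ∃ ε : ℝ, 0 < ε ∧ ∀ (M₁ : ℕ) (_ : 1 ≤ M₁) (Z : Set (Site (F.P K) 0)) (_ : side (F.P K).L M₁ k ∣ (F.P K).sitesPerDir 0),
      ∃ B : ℝ, 0 ≤ B ∧ ∀ (W : MSField (F.P K) (SU N)) (U₀ : GaugeField (F.P K) 0 (SU N)),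
        AgreeOn (Bj M₁ Z k) (avgFamily (avOfRecord F N K) U₀) W →
        (∀ i : Fin (constrCard (Bj M₁ Z k) k), ∃ U' : GaugeField (F.P K) 0 (SU N),
          (∀ b ∈ feeds (((constrEnum (Bj M₁ Z k) k).symm i).1 : ℕ) ((constrEnum (Bj M₁ Z k) k).symm i).2.1, U' b = U₀ b) ∧ SmallBelow (avOfRecord F N K) k U') →
        (∀ (j : ℕ), 1 ≤ j → j ≤ k → ∀ y : Site (F.P K) j, embIter j y ∈ maxDomT M₁ Z j → ∃ U' : GaugeField (F.P K) 0 (SU N),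
          (∀ c : PBond (F.P K) j, (c.src = y ∨ c.tgt = y) → ∀ b₀ : PBond (F.P K) 0,
            (iterBlockOf j b₀.src = c.src ∨ iterBlockOf j b₀.src = c.tgt) → (iterBlockOf j b₀.tgt = c.src ∨ iterBlockOf j b₀.tgt = c.tgt) → U' b₀ = U₀ b₀) ∧
          SmallBelow (avOfRecord F N K) k U') →
        (∀ (j : ℕ), 1 ≤ j → j ≤ k → ∀ y : Site (F.P K) j, embIter j y ∈ maxDomT M₁ Z j →
          PlaqSmallOn (boxPlaqs (P := F.P K) (j := 0)
            (fun κ => lift (F.P K) (embIter j y) κ - ((((F.P K).L ^ j : ℕ) : ℤ) + ((((F.P K).L ^ j - 1) / 2 : ℕ) : ℤ)))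
            (fun κ => lift (F.P K) (embIter j y) κ + ((((F.P K).L ^ j : ℕ) : ℤ) + ((((F.P K).L ^ j - 1) / 2 : ℕ) : ℤ)))) ε U₀) →
        ∃ H : (Fin (constrCard (Bj M₁ Z k) k) → lieSU (Fin N)) → PBond (F.P K) 0 → lieSU (Fin N),
          (∀ v, fderiv ℝ (msChart F N K k (Bj M₁ Z k) W U₀) 0 (H v) = v) ∧
          ∀ i : Fin (constrCard (Bj M₁ Z k) k), 1 ≤ ((((constrEnum (Bj M₁ Z k) k).symm i).1 : ℕ)) → ∀ ξ : lieSU (Fin N),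
            ∃ x : PBond (F.P K) 0 → lieSU (Fin N), fderiv ℝ (msChart F N K k (Bj M₁ Z k) W U₀) 0 x = Pi.single i ξ ∧
              ∑ b, ‖(x b : Matrix (Fin N) (Fin N) ℂ)‖
                ≤ (2 * (F.P K).d * (k + 1) * (2 * (F.P K).d + 1) ^ k * ((F.P K).L ^ (F.P K).d) ^ k : ℕ) * B * ‖ξ‖ := by
  obtain ⟨ε, hε, hmain⟩ := exists_rightInverse_l1Letter_explicit (F := F) (N := N) (K := K) (k := k) hkK
  refine ⟨ε, hε, fun M₁ hM1 Z hdiv => ?_⟩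
  obtain ⟨B, hB0, hB⟩ := hmain M₁ hM1 Z hdiv
  refine ⟨B, hB0, fun W U₀ hU hprox hproxSite hplaq => ?_⟩
  obtain ⟨H, hHinv, -, -, hrow⟩ := hB W U₀ hU hprox hproxSite hplaq
  exact ⟨H, hHinv, fun i _ ξ => ⟨H (Pi.single i ξ), hHinv _, hrow i ξ⟩⟩

end Record

end Summit.QuantumFields.YangMills.BalabanUVNodes.N12DirectSurjHullCount

end
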